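import Summits.AnomalousDissipation.AnomalousDissipation.Theses.TameRoughRigidity
import Summits.AnomalousDissipation.AnomalousDissipation.Theorems.TaylorCertificatesSteadyStatesLoudBoundedStubGpAdmissible
import Summits.AnomalousDissipation.AnomalousDissipation.Theorems.TameRoughRigidityTameClosureTightLimit
import Summits.AnomalousDissipation.AnomalousDissipation.Theorems.TameRoughRigidityTameClosureCutoffTest
import Summits.AnomalousDissipation.AnomalousDissipation.Theorems.TameRoughRigidityTameClosureCutoffFlux
import Summits.AnomalousDissipation.AnomalousDissipation.Theorems.TameRoughRigidityTameClosureProjectedStress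
import Summits.AnomalousDissipation.AnomalousDissipation.Theorems.TameRoughRigidityTameClosureCutoffAssembly
import Summits.AnomalousDissipation.AnomalousDissipation.Theorems.TameRoughRigidityTameClosureLimitExact
import Summits.AnomalousDissipation.AnomalousDissipation.Theorems.TameRoughRigidityTameClosureSymmetrise
import Literature.Analysis.FluidPDE.CylindricalGenerator
import HarnessLib

/-!
# Tame closure — crux `TameRoughRigidity.TameClosure` (stmt-AnomalousDissipation-18402), line `cutoff_compactness`

K (#4 of route `route-AnomalousDissipation-TameRoughRigidity`): for the pinned Galloway–Proctor force `f_GP` and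
every energy level `E` and mean-enstrophy level `G₁`, if for every `r > 0` there is a Borel probability
measure on `H = L²_σ(T³)` with integrable energy, mean energy `≤ E`, mean enstrophy `≤ G₁` and Φ-uniform
cylindrical forced-Euler defect `≤ r (∫ ‖∇Φ'(v)‖² dμ)^{1/2}`, then `f_GP` carries an exact stationary
statistical solution of forced Euler (FMRT) with the same two bounds.

PROOF = the line `Cruxes/TameClosure/Lines/cutoff_compactness.lean` (strategist; reshaped by the lead into seven
registered stubs, each landed in its own `Theorems/TameRoughRigidityTameClosure<Stub>.lean` file `--supports` the
crux): S1 `stub_tightLimit` (Chebyshev + Rellich tightness, Prokhorov, lsc bounds), S2 = S2a `stub_cutoffTest`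
(the product cut-off test `Ψ(v) = χ(|P_K v|²/ρ) Φ(v)` and its differential) + S2b `stub_cutoffFlux` (generator
bookkeeping, Cauchy–Schwarz, Bernstein flux bound, Pythagoras) + S2c `stub_projectedStress` (Galerkin-projected
Reynolds stress, spectral tail) + S2d `stub_cutoffAssembly` (the cut-off scheme on the tame class), S3
`stub_limitExact` (abstract weak-limit lemma), S4 `stub_symmetrise` (time-reversal symmetrisation); composed here
sorry-free (`cutoffScheme_of_pieces`, `tameClosureSmooth_of_pieces` — tame closure for EVERY smooth force —, and
`TameClosure_of`, the crux BY NAME, pinning `f = f_GP`, smooth by the landed `stub_gpAdmissible`).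
Technique: Foias–Manley–Rosa–Temam's Galerkin cut-off cylindrical tests (FMRT 2001 Ch. IV App. B.1) transplanted
from the 2-D energy equation to the 3-D closure of near-stationary statistics at bounded mean enstrophy; the tame
tail bound `∫ |Q_K v|² dν ≤ G₁/(4π²(K²+1))` replaces the missing 3-D structure.

## References

* C. Foias, O. Manley, R. Rosa, R. Temam, *Navier–Stokes Equations and Turbulence*, CUP (2001), Ch. IV §1.2
  Def. 1.3 (1.29)–(1.31); §3.1 Prop. 3.1; App. B.1–B.2. [FoiasManleyRosaTemam2001]
* P. Billingsley, *Convergence of Probability Measures*, 2nd ed., Thm. 5.1 (Prokhorov).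
* P. Constantin, A. Tarfulea, V. Vicol, arXiv:1305.7089 §4 (2-D inviscid limits of stationary statistical solutions).
-/

set_option linter.dupNamespace false

noncomputable section

namespace Summit.AnomalousDissipation.AnomalousDissipation.Theorems.TameRoughRigidity.TameClosure

open MeasureTheory Filter Topology UnitAddTorus
open scoped InnerProductSpace RealInnerProductSpace ENNReal NNReal
open Literature.Analysis.FunctionSpaces Literature.Analysis.FluidPDE
open Summit.AnomalousDissipation.AnomalousDissipation.Theses.TameRoughRigidity

/-- Local notation: real vector fields on `T³`. -/
local notation "Vec3" => (UnitAddTorus (Fin 3)) → (EuclideanSpace ℝ (Fin 3))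
/-- Local notation: `L²(T³; ℝ³)`. -/
local notation "L2" => (Lp (EuclideanSpace ℝ (Fin 3)) 2 (volume : Measure (UnitAddTorus (Fin 3))))
/-- Local notation: the energy space `H`. -/
local notation "H3" => (Torus.energySpace (Fin 3))

/-- **S2: the cut-off scheme on the tame class** (the registered S2 signature of the original line), from the four
landed pieces S2a–S2d (one line). [cite: FoiasManleyRosaTemam2001, Ch. IV App. B.1–B.2] -/
theorem cutoffScheme_of_pieces (f : Vec3) (hf : Torus.IsSmooth f) (Φ : Torus.CylindricalTest (Fin 3))
    (E G₁ ε : ℝ) (hε : 0 < ε) :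
    ∃ ρ₀ : ℝ, ∀ ρ : ℝ, ρ₀ ≤ ρ →
      ∃ (c h : H3 → ℝ) (Ψ : Torus.CylindricalTest (Fin 3)) (δ : ℝ), 0 < δ ∧
        Continuous c ∧ Continuous h ∧ (∀ v, 0 ≤ c v ∧ c v ≤ 1) ∧ (∀ v : H3, ‖v‖ ^ 2 ≤ ρ → c v = 1) ∧
        (∃ C : ℝ, ∀ v, |h v| ≤ C) ∧
        ∀ ν : Measure H3, IsProbabilityMeasure ν → Integrable (fun v : H3 => ‖v‖ ^ 2) ν →
          Torus.ensembleEnergy ν ≤ E → Torus.ensembleEnstrophy ν ≤ ENNReal.ofReal G₁ →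
          |(∫ v, c v * Torus.nsGeneratorPairing 0 f v (Φ.grad v) ∂ν) - ∫ v, h v ∂ν| ≤ ε ∧
          (|∫ v, Torus.nsGeneratorPairing 0 f v (Ψ.grad v) ∂ν| ≤
              δ * Real.sqrt (∫ v, Torus.gradNormSq (Ψ.grad v) ∂ν) →
            |∫ v, c v * Torus.nsGeneratorPairing 0 f v (Φ.grad v) ∂ν| ≤ ε) :=
  stub_cutoffAssembly stub_cutoffTest stub_cutoffFlux stub_projectedStress f hf Φ E G₁ ε hε

/-- **Tame closure for EVERY smooth force, from the four pieces** (SORRY-FREE; the implication content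
of the skeleton; its conclusion is the body of the crux with the pin `f = f_GP` relaxed to `f` smooth, so
that `TameClosure_of` below is the only theorem whose type is the crux decl). Hypotheses: the statements
of S1–S4 verbatim. Proof: choose approximants `μₙ` at defect radius `rₙ = 1/(n+1)`; S1 gives a
subsequence `φ` and a tame weak limit `μ'`; for each cylindrical `Φ`, S3 — with `F = L₀Φ` (continuous
with quadratic growth by `Torus.continuous_nsGeneratorPairing_grad`,
`Torus.exists_abs_nsGeneratorPairing_grad_le`) and the scheme of S2 evaluated on `μ'` and on the
`μ_{φ n}` (all in the tame class), the eventual clause firing once `1/(φ n + 1) ≤ δ` — gives the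
Liouville identity of `μ'`; S4 turns `μ'` into an FMRT stationary statistical solution with the same
bounds. -/
theorem tameClosureSmooth_of_pieces
    (hS1 : ∀ (E G₁ : ℝ) (μ : ℕ → Measure H3),
      (∀ n, IsProbabilityMeasure (μ n)) → (∀ n, Integrable (fun v : H3 => ‖v‖ ^ 2) (μ n)) →
      (∀ n, Torus.ensembleEnergy (μ n) ≤ E) → (∀ n, Torus.ensembleEnstrophy (μ n) ≤ ENNReal.ofReal G₁) →
      ∃ φ : ℕ → ℕ, StrictMono φ ∧ ∃ μ' : Measure H3, IsProbabilityMeasure μ' ∧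
        Integrable (fun v : H3 => ‖v‖ ^ 2) μ' ∧ Torus.ensembleEnergy μ' ≤ E ∧
        Torus.ensembleEnstrophy μ' ≤ ENNReal.ofReal G₁ ∧
        ∀ h : H3 → ℝ, Continuous h → (∃ C : ℝ, ∀ v, |h v| ≤ C) →
          Tendsto (fun n => ∫ v, h v ∂(μ (φ n))) atTop (𝓝 (∫ v, h v ∂μ')))
    (hS2 : ∀ (f : Vec3), Torus.IsSmooth f → ∀ (Φ : Torus.CylindricalTest (Fin 3)) (E G₁ ε : ℝ), 0 < ε →
      ∃ ρ₀ : ℝ, ∀ ρ : ℝ, ρ₀ ≤ ρ →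
        ∃ (c h : H3 → ℝ) (Ψ : Torus.CylindricalTest (Fin 3)) (δ : ℝ), 0 < δ ∧
          Continuous c ∧ Continuous h ∧ (∀ v, 0 ≤ c v ∧ c v ≤ 1) ∧ (∀ v : H3, ‖v‖ ^ 2 ≤ ρ → c v = 1) ∧
          (∃ C : ℝ, ∀ v, |h v| ≤ C) ∧
          ∀ ν : Measure H3, IsProbabilityMeasure ν → Integrable (fun v : H3 => ‖v‖ ^ 2) ν →
            Torus.ensembleEnergy ν ≤ E → Torus.ensembleEnstrophy ν ≤ ENNReal.ofReal G₁ →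
            |(∫ v, c v * Torus.nsGeneratorPairing 0 f v (Φ.grad v) ∂ν) - ∫ v, h v ∂ν| ≤ ε ∧
            (|∫ v, Torus.nsGeneratorPairing 0 f v (Ψ.grad v) ∂ν| ≤
                δ * Real.sqrt (∫ v, Torus.gradNormSq (Ψ.grad v) ∂ν) →
              |∫ v, c v * Torus.nsGeneratorPairing 0 f v (Φ.grad v) ∂ν| ≤ ε))
    (hS3 : ∀ (μ : ℕ → Measure H3) (μ' : Measure H3),
      (∀ n, IsProbabilityMeasure (μ n)) → IsProbabilityMeasure μ' →
      (∀ h : H3 → ℝ, Continuous h → (∃ C : ℝ, ∀ v, |h v| ≤ C) →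
        Tendsto (fun n => ∫ v, h v ∂(μ n)) atTop (𝓝 (∫ v, h v ∂μ'))) →
      Integrable (fun v : H3 => ‖v‖ ^ 2) μ' →
      ∀ (F : H3 → ℝ), Continuous F → ∀ (A : ℝ), (∀ v, |F v| ≤ A * (1 + ‖v‖ ^ 2)) →
      (∀ ε : ℝ, 0 < ε → ∃ ρ₀ : ℝ, ∀ ρ : ℝ, ρ₀ ≤ ρ →
        ∃ (c h : H3 → ℝ), Continuous c ∧ Continuous h ∧ (∀ v, 0 ≤ c v ∧ c v ≤ 1) ∧
          (∀ v : H3, ‖v‖ ^ 2 ≤ ρ → c v = 1) ∧ (∃ C : ℝ, ∀ v, |h v| ≤ C) ∧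
          |(∫ v, c v * F v ∂μ') - ∫ v, h v ∂μ'| ≤ ε ∧
          (∀ n, |(∫ v, c v * F v ∂(μ n)) - ∫ v, h v ∂(μ n)| ≤ ε) ∧
          (∀ᶠ n in atTop, |∫ v, c v * F v ∂(μ n)| ≤ ε)) →
      Integrable F μ' ∧ ∫ v, F v ∂μ' = 0)
    (hS4 : ∀ (f : Vec3), Torus.IsSmooth f → ∀ (E G₁ : ℝ) (μ : Measure H3),
      IsProbabilityMeasure μ → Integrable (fun v : H3 => ‖v‖ ^ 2) μ →
      Torus.ensembleEnergy μ ≤ E → Torus.ensembleEnstrophy μ ≤ ENNReal.ofReal G₁ →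
      (∀ Φ : Torus.CylindricalTest (Fin 3),
        Integrable (fun v : H3 => Torus.nsGeneratorPairing 0 f v (Φ.grad v)) μ ∧
          ∫ v, Torus.nsGeneratorPairing 0 f v (Φ.grad v) ∂μ = 0) →
      ∃ μ' : Measure H3, Torus.IsStationaryStatisticalSolution 0 f μ' ∧
        Integrable (fun v : H3 => ‖v‖ ^ 2) μ' ∧ Torus.ensembleEnergy μ' ≤ E ∧
        Torus.ensembleEnstrophy μ' ≤ ENNReal.ofReal G₁)
    (f : Vec3) (hfs : Torus.IsSmooth f) (E G₁ : ℝ)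
    (hnear : ∀ r : ℝ, 0 < r → ∃ μ : Measure H3, IsProbabilityMeasure μ ∧
      Integrable (fun v : H3 => ‖v‖ ^ 2) μ ∧ Torus.ensembleEnergy μ ≤ E ∧
      Torus.ensembleEnstrophy μ ≤ ENNReal.ofReal G₁ ∧
      (∀ Φ : Torus.CylindricalTest (Fin 3),
        Integrable (fun v : H3 => Torus.nsGeneratorPairing 0 f v (Φ.grad v)) μ ∧
          |∫ v, Torus.nsGeneratorPairing 0 f v (Φ.grad v) ∂μ| ≤
            r * Real.sqrt (∫ v, Torus.gradNormSq (Φ.grad v) ∂μ))) :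
    ∃ μ : Measure H3, Torus.IsStationaryStatisticalSolution 0 f μ ∧
      Integrable (fun v : H3 => ‖v‖ ^ 2) μ ∧ Torus.ensembleEnergy μ ≤ E ∧
      Torus.ensembleEnstrophy μ ≤ ENNReal.ofReal G₁ := by
  -- approximants at defect radius `1/(n+1)`
  have hex : ∀ n : ℕ, ∃ μ : Measure H3, IsProbabilityMeasure μ ∧
      Integrable (fun v : H3 => ‖v‖ ^ 2) μ ∧ Torus.ensembleEnergy μ ≤ E ∧
      Torus.ensembleEnstrophy μ ≤ ENNReal.ofReal G₁ ∧
      (∀ Φ : Torus.CylindricalTest (Fin 3),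
        Integrable (fun v : H3 => Torus.nsGeneratorPairing 0 f v (Φ.grad v)) μ ∧
          |∫ v, Torus.nsGeneratorPairing 0 f v (Φ.grad v) ∂μ| ≤
            (1 / ((n : ℝ) + 1)) * Real.sqrt (∫ v, Torus.gradNormSq (Φ.grad v) ∂μ)) :=
    fun n => hnear (1 / ((n : ℝ) + 1)) (by positivity)
  choose μ hμ using hex
  -- S1: a tame weak limit along a subsequence
  obtain ⟨φ, hφ, μ', hprob', hint', hE', hG', hweak⟩ :=
    hS1 E G₁ μ (fun n => (hμ n).1) (fun n => (hμ n).2.1) (fun n => (hμ n).2.2.1)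
      (fun n => (hμ n).2.2.2.1)
  -- S3 fed by S2: the exact cylindrical Liouville identity of the limit
  have hgen : ∀ Φ : Torus.CylindricalTest (Fin 3),
      Integrable (fun v : H3 => Torus.nsGeneratorPairing 0 f v (Φ.grad v)) μ' ∧
        ∫ v, Torus.nsGeneratorPairing 0 f v (Φ.grad v) ∂μ' = 0 := by
    intro Φ
    obtain ⟨A, -, hA⟩ := Torus.exists_abs_nsGeneratorPairing_grad_le 0 (hfs.memLp 2) Φ
    refine hS3 (fun n => μ (φ n)) μ' (fun n => (hμ (φ n)).1) hprob' hweak hint'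
      (fun v => Torus.nsGeneratorPairing 0 f v (Φ.grad v))
      (Torus.continuous_nsGeneratorPairing_grad 0 ((hfs.memLp 2).integrable one_le_two) Φ) A hA ?_
    intro ε hε
    obtain ⟨ρ₀, hρ₀⟩ := hS2 f hfs Φ E G₁ ε hε
    refine ⟨ρ₀, fun ρ hρ => ?_⟩
    obtain ⟨c, h, Ψ, δ, hδ, hc, hh, hc01, hc1, hhb, hclass⟩ := hρ₀ ρ hρ
    refine ⟨c, h, hc, hh, hc01, hc1, hhb, (hclass μ' hprob' hint' hE' hG').1, fun n =>
      (hclass (μ (φ n)) (hμ (φ n)).1 (hμ (φ n)).2.1 (hμ (φ n)).2.2.1 (hμ (φ n)).2.2.2.1).1, ?_⟩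
    -- eventually the defect radius `1/(φ n + 1)` is below `δ`
    obtain ⟨N, hN⟩ := exists_nat_gt (1 / δ)
    refine Filter.eventually_atTop.2 ⟨N, fun n hn => ?_⟩
    have hμn := hμ (φ n)
    refine (hclass (μ (φ n)) hμn.1 hμn.2.1 hμn.2.2.1 hμn.2.2.2.1).2 ?_
    obtain ⟨-, hdef⟩ := hμn.2.2.2.2 Ψ
    refine hdef.trans (mul_le_mul_of_nonneg_right ?_ (Real.sqrt_nonneg _))
    have h1 : (N : ℝ) ≤ (φ n : ℝ) := Nat.cast_le.2 (hn.trans (hφ.id_le n))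
    have hpos : (0 : ℝ) < (φ n : ℝ) + 1 := by positivity
    have h2 : 1 / δ < (φ n : ℝ) + 1 := by linarith
    have h3 : 1 < ((φ n : ℝ) + 1) * δ := (div_lt_iff₀ hδ).1 h2
    rw [div_le_iff₀ hpos]
    linarith [h3, mul_comm ((φ n : ℝ) + 1) δ]
  -- S4: symmetrise the limit into an FMRT stationary statistical solution with the same bounds
  exact hS4 f hfs E G₁ μ' hprob' hint' hE' hG' hgen

/-- **The crux BY NAME: `TameRoughRigidity.TameClosure` (K, tame closure) holds.** From the seven landed stubs through
the sorry-free composition `tameClosureSmooth_of_pieces`; the pinned force `f_GP` is smooth by the landed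
`SteadyStatesLoudBounded.GpAdmissible.stub_gpAdmissible` (stated on the same inline expression).
[cite: FoiasManleyRosaTemam2001, Ch. IV §1.2, §3.1, App. B.1–B.2] -/
theorem TameClosure_of : TameClosure := by
  intro f hf E G₁ hnear
  have hfs : Torus.IsSmooth f := by
    rw [hf]
    exact Summit.AnomalousDissipation.AnomalousDissipation.Theorems.SteadyStatesLoudBounded.GpAdmissible.stub_gpAdmissible.1
  exact tameClosureSmooth_of_pieces stub_tightLimit cutoffScheme_of_pieces stub_limitExact stub_symmetrise
    f hfs E G₁ hnear

end Summit.AnomalousDissipation.AnomalousDissipation.Theorems.TameRoughRigidity.TameClosure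

end
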